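import Literature.Geometry.Kaehler.ComplexTorusAbelianDivisorClass
import Literature.LinearAlgebra.Alternating.WedgeOneWedgeCalculus
import HarnessLib

/-!
# Auffarth's Corollary 2.6 and Theorem 1.1 (up to sign) for abelian divisors in every dimension, at torus level
# (`α ∈ NS(X)`, `α ∧ α = 0` ⟹ `α = m[Z]` for an abelian divisor `Z`)

Layer `Literature/Geometry/Kaehler`, namespace `Literature.Geometry.Kaehler.ComplexTorus`; lane `lit-hodgefound`
(Track 2 foundations library, Layer A4), row **A4-61** (seat skel-4), FILE 3. Sequel of FILE 1
(`ComplexTorusAbelianDivisorClass`: `[Y]` is primitive, `rad [Y] = T_Y`, and every integral class whose radical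
contains `T_Y` is an integer multiple of `[Y]`; the surjectivity of Thm. 1.1 was stated there for `g = 2` only).

## Source, VERBATIM

R. Auffarth, *Elliptic curves on abelian varieties*, Illinois J. Math. **59** (2015)
[Auffarth2015EllipticCurvesAbelianVarieties; open copy `paper:arxiv-1507.08617`], §2 (p0005–p0006):

> **Corollary 2.6.** If `α ∈ NS(A)`, then `α = m[Z]` for some abelian divisor `Z` and some `m ∈ ℤ` if and only if
> `α² = 0` in `𝔄^*(A)`.
> **Corollary 2.9.** A class `α ∈ NS(A)` comes from an abelian divisor if and only if it is effective, primitive and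
> `α² = 0` in `𝔄^*(A)`.
> **Theorem 2.10.** Let `A` be an abelian variety of dimension `n`. Then the map `Z ↦ [Z]` induces a bijective
> correspondence between abelian divisors on `A` and primitive elements `α ∈ NS(A)` that satisfy `α² = 0` in
> `𝔄^*(A)` and `deg α > 0`.
> [Thm. 1.1, p0003:] In particular, `A` contains an elliptic curve if and only if there exists a non-zero class
> `α ∈ NS(A)` that satisfies `α² = 0`.

## Torus-level reading and the proof formalized (all dimensions `g`, `|ι| = 2g = m + 2`)

`α² = 0` is read in `H⁴(X)`: `E ∧ E = 0` for the real `2`-form `E ∈ NS(X)` (`IsNSForm`). The key linear-algebra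
step, replacing the printed route through Nakai–Moishezon (Prop. 2.5), is the PLÜCKER RELATION: by row A4-13 /
`WedgeTwoTwoApply` (`wedge_self_apply_two`), `(E ∧ E)(a, b, c, d) = 2(E(a,b)E(c,d) − E(a,c)E(b,d) + E(a,d)E(b,c))`, so
`E ∧ E = 0` with `E(u₁, v₁) ≠ 0` forces the `E`-orthogonal complement of `⟨u₁, v₁⟩` into the RADICAL of `E`
(`exists_radical_decomp_of_wedge_self_eq_zero`): every vector is `w + a u₁ + b v₁` with `E(w, ·) = 0`, i.e. `E` has
rank `2`. For `E ∈ NS(X)`, `E ≠ 0`, the radical `Λ(L)⁰` (Lange (1.22); tree `nsRadical`) is then a complex lattice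
subspace of real codimension exactly `2` (`subRank_nsRadical_eq_of_wedge_self_eq_zero`: it is the kernel of
`x ↦ (E(Φx, v₁), E(u₁, Φx))`, rank–nullity, evenness), i.e. an ABELIAN DIVISOR `Y_E = K(L)⁰`, and FILE 1's
`exists_int_smul_cycleForm_of_integral` gives **Corollary 2.6**: `E = c[Y_E]` with `c ∈ ℤ ∖ 0`
(`IsNSForm.exists_int_smul_cycleForm_of_wedge_self_eq_zero`; conversely `(c[Y]) ∧ (c[Y]) = 0`,
`wedge_self_eq_zero_of_eq_smul_cycleForm`), and **Theorem 2.10 / 1.1 up to sign** for primitive classes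
(`exists_cycleForm_of_primitive_of_wedge_self_eq_zero'`), together with the "In particular": **`X` contains an abelian
divisor iff `NS(X)` has a non-zero class of square zero** (`exists_abelianDivisor_iff_exists_isNSForm_wedge_self_eq_zero`).
The sign `deg α > 0` in dimension `g` involves `Θ^{g−1}` and is supplied for `g = 2` only (FILE 2).

## Contents (theorems only; no definition, no named fact)

* §1 `plucker_of_wedge_self_eq_zero`, **`exists_radical_decomp_of_wedge_self_eq_zero`** (rank `≤ 2`).
* §2 **`subRank_nsRadical_eq_of_wedge_self_eq_zero`** (`rk(Λ ∩ Λ(L)⁰) = 2g − 2` for `0 ≠ E ∈ NS(X)` with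
  `E ∧ E = 0`), **`IsNSForm.exists_int_smul_cycleForm_of_wedge_self_eq_zero`** (Cor. 2.6, ⇐),
  `wedge_self_eq_zero_of_eq_smul_cycleForm` (Cor. 2.6, ⇒), **`exists_cycleForm_of_primitive_of_wedge_self_eq_zero'`**
  (Thm. 2.10 up to sign, every `g`), **`exists_abelianDivisor_iff_exists_isNSForm_wedge_self_eq_zero`**,
  `IsNSForm.not_isSimple_of_wedge_self_eq_zero` (`g ≥ 2`: such a torus is not simple).

## References

* [Auffarth2015EllipticCurvesAbelianVarieties] R. Auffarth, *Elliptic curves on abelian varieties*, Illinois J.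
  Math. 59 (2015) 271–279; arXiv:1507.08617 — Cor. 2.6, Cor. 2.9, Thm. 2.10, Thm. 1.1.
* [Kani1994EllipticCurvesAbelianSurfaces] E. Kani, *Elliptic curves on abelian surfaces*, Manuscripta Math. 84 (1994)
  199–223 (surfaces).
* [Lange2023AbelianVarietiesComplex] H. Lange, *Abelian Varieties over the Complex Numbers* (2023), §1.5.4 (1.22).
* [McDuffSalamon2017] D. McDuff, D. Salamon, *Introduction to Symplectic Topology* (3rd ed.), §2.1 (rank of a `2`-form,
  `ω ∧ ω` and decomposability).
-/

noncomputable section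

set_option maxSynthPendingDepth 3

open Module Function Complex Matrix

namespace Literature.Geometry.Kaehler

namespace ComplexTorus

/-! ## §1 `E ∧ E = 0` forces rank `≤ 2`: the Plücker relation and the radical decomposition -/

section Plucker

variable {E : Type*} [NormedAddCommGroup E] [NormedSpace ℂ E]

/-- **The Plücker relation**: `E ∧ E = 0` gives `E(a,b)E(c,d) − E(a,c)E(b,d) + E(a,d)E(b,c) = 0` for all
`a, b, c, d` (`(E ∧ E)(a,b,c,d)` is twice this expression, `wedge_self_apply_two`).
[cite: McDuffSalamon2017, §2.1 (exterior powers of a `2`-form)] -/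
theorem plucker_of_wedge_self_eq_zero (η : E [⋀^Fin 2]→L[ℝ] ℝ) (hηη : η.wedge η = 0) (a b c d : E) :
    η ![a, b] * η ![c, d] - η ![a, c] * η ![b, d] + η ![a, d] * η ![b, c] = 0 := by
  have h := ContinuousAlternatingMap.wedge_self_apply_two η a b c d
  rw [hηη, ContinuousAlternatingMap.coe_zero, Pi.zero_apply] at h
  linarith

/-- **A `2`-form with `E ∧ E = 0` has rank `≤ 2`**: if `E(u₁, v₁) ≠ 0` then every vector is `w + a u₁ + b v₁` with
`w` in the RADICAL of `E` — namely `w = x − (E(x,v₁)/c) u₁ − (E(u₁,x)/c) v₁`, `c = E(u₁, v₁)`, which is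
`E`-orthogonal to `u₁, v₁`, and two such vectors are `E`-orthogonal by the Plücker relation.
[cite: McDuffSalamon2017, §2.1 (rank of a `2`-form)] [cite: Auffarth2015EllipticCurvesAbelianVarieties, §2 Cor. 2.6] -/
theorem exists_radical_decomp_of_wedge_self_eq_zero (η : E [⋀^Fin 2]→L[ℝ] ℝ) (hηη : η.wedge η = 0) {u₁ v₁ : E}
    (hc : η ![u₁, v₁] ≠ 0) (x : E) :
    ∃ w : E, (∀ y, η ![w, y] = 0) ∧ ∃ a b : ℝ, x = w + a • u₁ + b • v₁ := by
  set c := η ![u₁, v₁] with hcdef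
  -- the projection `π z = z − (E(z,v₁)/c) u₁ − (E(u₁,z)/c) v₁` onto the `E`-orthogonal of `⟨u₁, v₁⟩`
  set π : E → E := fun z ↦ z + (-(η ![z, v₁] / c)) • u₁ + (-(η ![u₁, z] / c)) • v₁ with hπ
  have hvu : η ![v₁, u₁] = -c := by rw [hcdef, twoForm_swap]
  have hπu : ∀ z, η ![π z, u₁] = 0 := fun z ↦ by
    simp only [hπ, twoForm_add_left, twoForm_smul_left, twoForm_self, hvu]
    rw [twoForm_swap η z u₁]
    field_simp
    ring
  have hπv : ∀ z, η ![π z, v₁] = 0 := fun z ↦ by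
    simp only [hπ, twoForm_add_left, twoForm_smul_left, twoForm_self]
    rw [← hcdef]
    field_simp
    ring
  have hππ : ∀ z z', η ![π z, π z'] = 0 := fun z z' ↦ by
    have hp := plucker_of_wedge_self_eq_zero η hηη u₁ v₁ (π z) (π z')
    have h1 : η ![u₁, π z] = 0 := by rw [twoForm_swap, hπu, neg_zero]
    have h2 : η ![u₁, π z'] = 0 := by rw [twoForm_swap, hπu, neg_zero]
    rw [h1, h2, zero_mul, zero_mul, sub_zero, add_zero, ← hcdef] at hp
    exact (mul_eq_zero.1 hp).resolve_left hc
  have hdecomp : ∀ z, z = π z + (η ![z, v₁] / c) • u₁ + (η ![u₁, z] / c) • v₁ := fun z ↦ by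
    simp only [hπ]
    module
  refine ⟨π x, fun y ↦ ?_, η ![x, v₁] / c, η ![u₁, x] / c, hdecomp x⟩
  rw [hdecomp y, twoForm_add_right, twoForm_add_right, twoForm_smul_right, twoForm_smul_right, hππ, hπu, hπv]
  ring

end Plucker

/-! ## §2 Corollary 2.6 and Theorem 2.10 (up to sign) in every dimension -/

section AnyDimension

variable {ι : Type*} [Fintype ι] [DecidableEq ι] {E : Type*} [NormedAddCommGroup E] [NormedSpace ℂ E]
  (Φ : (ι → ℝ) ≃L[ℝ] E)

omit [Fintype ι] in
/-- The orientation sign is insensitive to a cast `Fin a = Fin b` of the enumeration (private copy of p36's).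
[folklore] -/
private theorem orientationSign_comp_cast₅ {κ F : Type*} [NormedAddCommGroup F] [NormedSpace ℂ F] [DecidableEq κ]
    (Ψ : (κ → ℝ) ≃L[ℝ] F) {a b : ℕ} (h : a = b) (f : Fin b → κ) :
    orientationSign Ψ (f ∘ Fin.cast h) = orientationSign Ψ f := by
  subst h; rfl

omit [Fintype ι] [DecidableEq ι] in
/-- A non-zero `2`-form takes a non-zero value on some pair. [folklore] -/
private theorem exists_apply_ne_zero {η : E [⋀^Fin 2]→L[ℝ] ℝ} (hne : η ≠ 0) : ∃ u v : E, η ![u, v] ≠ 0 := by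
  by_contra h
  push Not at h
  apply hne
  ext v
  have hv : v = ![v 0, v 1] := by
    funext i; fin_cases i <;> rfl
  rw [hv, h, ContinuousAlternatingMap.coe_zero, Pi.zero_apply]

/-- **For `0 ≠ E ∈ NS(X)` with `E ∧ E = 0` the radical `Λ(L)⁰` has rank `2g − 2`** (an abelian divisor): it is the
kernel of `x ↦ (E(Φx, v₁), E(u₁, Φx))` for a pair with `E(u₁, v₁) ≠ 0` (§1), so of real codimension `≤ 2`
(rank–nullity), of codimension `> 0` (`E ≠ 0`), and of even rank (a complex subspace).
[cite: Auffarth2015EllipticCurvesAbelianVarieties, §2 Cor. 2.6] [cite: Lange2023AbelianVarietiesComplex, §1.5.4 (1.22), p. 58] -/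
theorem subRank_nsRadical_eq_of_wedge_self_eq_zero [FiniteDimensional ℂ E] {η : E [⋀^Fin 2]→L[ℝ] ℝ}
    (hη : IsNSForm Φ η) (hne : η ≠ 0) (hηη : η.wedge η = 0) :
    subRank (nsRadical Φ η) + 2 = Fintype.card ι := by
  classical
  obtain ⟨u₁, v₁, hc⟩ := exists_apply_ne_zero hne
  set W := nsRadical Φ η with hWdef
  have hW : IsLatticeSubspace W := hη.isLatticeSubspace_nsRadical
  have hWc : IsComplexSubspace Φ W := isComplexSubspace_nsRadical Φ hη.type_one_one
  -- `W = ker (x ↦ (E(Φx, v₁), E(u₁, Φx)))`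
  let L : (ι → ℝ) →ₗ[ℝ] ℝ × ℝ :=
    { toFun := fun x ↦ (η ![Φ x, v₁], η ![u₁, Φ x])
      map_add' := fun x y ↦ by
        simp only [map_add, twoForm_add_left, twoForm_add_right, Prod.mk_add_mk]
      map_smul' := fun r x ↦ by
        simp only [map_smul, twoForm_smul_left, twoForm_smul_right, RingHom.id_apply, Prod.smul_mk,
          smul_eq_mul] }
  have hker : LinearMap.ker L = W := by
    ext x
    rw [LinearMap.mem_ker, hWdef, mem_nsRadical_iff_forall]
    constructor
    · intro hx
      have h1 : η ![Φ x, v₁] = 0 := congrArg Prod.fst hx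
      have h2 : η ![u₁, Φ x] = 0 := congrArg Prod.snd hx
      obtain ⟨w, hw, a, b, hxw⟩ := exists_radical_decomp_of_wedge_self_eq_zero η hηη hc (Φ x)
      -- `a = E(Φx, v₁)/c = 0`, `b = E(u₁, Φx)/c = 0`: so `Φ x = w` is in the radical
      have ha : a = 0 := by
        have h := congrArg (fun z ↦ η ![z, v₁]) hxw
        simp only [twoForm_add_left, twoForm_smul_left, hw, twoForm_self, zero_add, mul_zero, add_zero] at h
        rw [h1] at h
        exact (mul_eq_zero.1 h.symm).resolve_right hc
      have hb : b = 0 := by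
        have h := congrArg (fun z ↦ η ![u₁, z]) hxw
        simp only [twoForm_add_right, twoForm_smul_right, twoForm_self, mul_zero, add_zero] at h
        rw [twoForm_swap η u₁ w, hw, neg_zero, zero_add, h2] at h
        exact (mul_eq_zero.1 h.symm).resolve_right hc
      rw [ha, hb, zero_smul, zero_smul, add_zero, add_zero] at hxw
      intro v
      rw [hxw]
      exact hw v
    · intro hx
      have h2 : η ![u₁, Φ x] = 0 := by rw [twoForm_swap, hx, neg_zero]
      change (η ![Φ x, v₁], η ![u₁, Φ x]) = 0
      rw [hx, h2]
      rfl
  -- rank–nullity: `finrank W + finrank (range L) = |ι|`, `finrank (range L) ≤ 2`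
  have hrn := L.finrank_range_add_finrank_ker
  rw [hker, finrank_fintype_fun_eq_card] at hrn
  have hrange : finrank ℝ (LinearMap.range L) ≤ 2 := by
    have h := Submodule.finrank_le (LinearMap.range L)
    rw [Module.finrank_prod, Module.finrank_self] at h
    exact h
  -- `W ≠ ⊤` (`E ≠ 0`), rank is even, `|ι|` is even
  have hWt : W ≠ ⊤ := fun h ↦ hne ((nsRadical_eq_top_iff Φ η).1 h)
  have hlt : finrank ℝ W < Fintype.card ι := by
    have h := Submodule.finrank_lt hWt
    rwa [finrank_fintype_fun_eq_card] at h
  have hfr : finrank ℝ W = subRank W := finrank_eq_subRank hW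
  have hev := subRank_eq_two_mul_finrank Φ hW hWc
  have hcard := card_eq_two_mul_finrank Φ
  omega

/-- **Corollary 2.6 at torus level, every dimension (⇐): a non-zero `E ∈ NS(X)` with `E ∧ E = 0` is a non-zero
INTEGER multiple of the class of an abelian divisor** — of its radical torus `Y_E = K(L)⁰`, positively framed.
(`E ≠ 0` is assumed: for `E = 0` the printed "`α = m[Z]` for some abelian divisor `Z`" needs `m = 0` AND an abelian
divisor to exist, which fails on a simple `X` of dimension `≥ 2`.)
[cite: Auffarth2015EllipticCurvesAbelianVarieties, §2 Cor. 2.6] [cite: Lange2023AbelianVarietiesComplex, §1.5.4 (1.22), p. 58] -/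
theorem IsNSForm.exists_int_smul_cycleForm_of_wedge_self_eq_zero [FiniteDimensional ℂ E] {m : ℕ}
    (e : Fin (m + 2) ≃ ι) {η : E [⋀^Fin 2]→L[ℝ] ℝ} (hη : IsNSForm Φ η) (hne : η ≠ 0) (hηη : η.wedge η = 0) :
    ∃ (W : Submodule ℝ (ι → ℝ)) (hW : IsLatticeSubspace W) (hWc : IsComplexSubspace Φ W)
      (eY : Fin m ≃ Fin (subRank W)) (hpos : orientationSign (subtorusPeriod Φ W hW hWc) eY = 1),
      W ≠ ⊤ ∧ (∀ w ∈ W, ∀ v, η ![Φ w, v] = 0) ∧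
        ∃ c : ℤ, c ≠ 0 ∧ ofRealForm η = (c : ℂ) • (SubtorusFrame.ofSubspace Φ W hW hWc eY hpos).cycleForm e := by
  classical
  set W := nsRadical Φ η with hWdef
  have hW : IsLatticeSubspace W := hη.isLatticeSubspace_nsRadical
  have hWc : IsComplexSubspace Φ W := isComplexSubspace_nsRadical Φ hη.type_one_one
  have hWt : W ≠ ⊤ := fun h ↦ hne ((nsRadical_eq_top_iff Φ η).1 h)
  have hcard : Fintype.card ι = m + 2 := by rw [← Fintype.card_congr e, Fintype.card_fin]
  have hsub : subRank W = m := by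
    have h := subRank_nsRadical_eq_of_wedge_self_eq_zero Φ hη hne hηη
    rw [← hWdef] at h
    omega
  obtain ⟨eY₀, hpos₀⟩ := exists_orientationSign_subtorusPeriod_eq_one Φ W hW hWc
  set eY : Fin m ≃ Fin (subRank W) := (finCongr hsub.symm).trans eY₀ with heY
  have hpos : orientationSign (subtorusPeriod Φ W hW hWc) eY = 1 := by
    rw [heY]
    have h : (⇑((finCongr hsub.symm).trans eY₀) : Fin m → Fin (subRank W)) = ⇑eY₀ ∘ Fin.cast hsub.symm := rfl
    rw [h, orientationSign_comp_cast₅]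
    exact hpos₀
  have hrad : ∀ w ∈ W, ∀ v, η ![Φ w, v] = 0 := fun w hw v ↦ (mem_nsRadical_iff_forall Φ η).1 hw v
  have hradC : ∀ w ∈ W, ∀ v, ofRealForm η ![Φ w, v] = 0 := fun w hw v ↦ by
    rw [ofRealForm_apply, hrad w hw v, Complex.ofReal_zero]
  obtain ⟨c, hc, hiff⟩ := exists_int_smul_cycleForm_of_integral Φ W hW hWc eY hpos e (ofRealForm η)
    (ofRealForm_mem_integralForms_two Φ hη) hradC
  refine ⟨W, hW, hWc, eY, hpos, hWt, hrad, c, hiff.1 ?_, hc⟩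
  intro h0
  apply hne
  apply ofRealForm_injective
  rw [h0]
  ext v
  simp

/-- **Corollary 2.6 (⇒): a multiple of the class of an abelian divisor has square zero**, `(c[Y]) ∧ (c[Y]) = 0`.
[cite: Auffarth2015EllipticCurvesAbelianVarieties, §2 Prop. 2.1 and Cor. 2.6] -/
theorem wedge_self_eq_zero_of_eq_smul_cycleForm {m : ℕ} (W : Submodule ℝ (ι → ℝ)) (hW : IsLatticeSubspace W)
    (hWc : IsComplexSubspace Φ W) (eY : Fin m ≃ Fin (subRank W))
    (hpos : orientationSign (subtorusPeriod Φ W hW hWc) eY = 1) (e : Fin (m + 2) ≃ ι) (c : ℂ)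
    {γ : E [⋀^Fin 2]→L[ℝ] ℂ} (h : γ = c • (SubtorusFrame.ofSubspace Φ W hW hWc eY hpos).cycleForm e) :
    γ.wedge γ = 0 := by
  rw [h, Literature.LinearAlgebra.Alternating.wedge_smul_left_complex,
    Literature.LinearAlgebra.Alternating.wedge_smul_right_complex,
    SubtorusFrame.cycleForm_wedge_self_eq_zero Φ _ e (by norm_num), smul_zero, smul_zero]

/-- **Theorem 2.10 / 1.1 up to sign, every dimension**: a PRIMITIVE integral Hodge class `γ ∈ H²(X, ℤ) ∩ H^{1,1}(X)`
with `γ ∧ γ = 0` is `±[Y]` for an abelian divisor `Y ⊂ X` (the radical torus of `γ`), which is determined by `γ`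
(FILE 1 `eq_of_cycleForm_ofSubspace_eq`). [cite: Auffarth2015EllipticCurvesAbelianVarieties, §2 Cor. 2.9 and Thm. 2.10] [cite: Kani1994EllipticCurvesAbelianSurfaces, (surfaces)] -/
theorem exists_cycleForm_of_primitive_of_wedge_self_eq_zero' [FiniteDimensional ℂ E] {m : ℕ} (e : Fin (m + 2) ≃ ι)
    {γ : E [⋀^Fin 2]→L[ℝ] ℂ} (hγ : γ ∈ integralHodgeClasses Φ 1)
    (hprim : ∀ (k : ℤ) (β : E [⋀^Fin 2]→L[ℝ] ℂ), β ∈ integralForms Φ 2 → (k : ℂ) • β = γ → k = 1 ∨ k = -1)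
    (hγγ : γ.wedge γ = 0) :
    ∃ (W : Submodule ℝ (ι → ℝ)) (hW : IsLatticeSubspace W) (hWc : IsComplexSubspace Φ W)
      (eY : Fin m ≃ Fin (subRank W)) (hpos : orientationSign (subtorusPeriod Φ W hW hWc) eY = 1),
      W ≠ ⊤ ∧
        (γ = (SubtorusFrame.ofSubspace Φ W hW hWc eY hpos).cycleForm e ∨
          γ = -(SubtorusFrame.ofSubspace Φ W hW hWc eY hpos).cycleForm e) := by
  obtain ⟨η, hηNS, rfl⟩ := (mem_integralHodgeClasses_one_iff_exists Φ).1 hγ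
  have hη : IsNSForm Φ η := (mem_neronSeveriGroup_iff Φ).1 hηNS
  have hne : η ≠ 0 := by
    intro h0
    have h := hprim 2 0 (zero_mem _) (by rw [h0]; ext v; simp)
    omega
  have hηη : η.wedge η = 0 := by
    apply ofRealForm_injective
    rw [ofRealForm_wedge, hγγ]
    ext v
    simp
  obtain ⟨W, hW, hWc, eY, hpos, hWt, hrad, c, -, hc⟩ :=
    hη.exists_int_smul_cycleForm_of_wedge_self_eq_zero Φ e hne hηη
  refine ⟨W, hW, hWc, eY, hpos, hWt, ?_⟩
  refine eq_or_eq_neg_cycleForm_of_primitive Φ W hW hWc eY hpos e (ofRealForm η)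
    (ofRealForm_mem_integralForms_two Φ hη) hprim fun w hw v ↦ ?_
  rw [ofRealForm_apply, hrad w hw v, Complex.ofReal_zero]

/-- **"In particular" (Thm. 1.1), every dimension: `X` contains an abelian divisor iff `NS(X)` has a non-zero class
of square zero** — a complex lattice subspace `W ≠ Λ ⊗ ℝ` of rank `2g − 2` exists iff some `0 ≠ E ∈ NS(X)` has
`E ∧ E = 0` (⇒: `E := [Y]`, row A4-23 integral Lefschetz `(1,1)`; ⇐: the radical torus).
[cite: Auffarth2015EllipticCurvesAbelianVarieties, §1 Thm. 1.1 ("In particular")] -/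
theorem exists_abelianDivisor_iff_exists_isNSForm_wedge_self_eq_zero [FiniteDimensional ℂ E] {m : ℕ}
    (e : Fin (m + 2) ≃ ι) :
    (∃ (W : Submodule ℝ (ι → ℝ)), IsLatticeSubspace W ∧ IsComplexSubspace Φ W ∧ subRank W = m) ↔
      ∃ η : E [⋀^Fin 2]→L[ℝ] ℝ, IsNSForm Φ η ∧ η ≠ 0 ∧ η.wedge η = 0 := by
  classical
  constructor
  · rintro ⟨W, hW, hWc, hsub⟩
    obtain ⟨eY₀, hpos₀⟩ := exists_orientationSign_subtorusPeriod_eq_one Φ W hW hWc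
    set eY : Fin m ≃ Fin (subRank W) := (finCongr hsub.symm).trans eY₀ with heY
    have hpos : orientationSign (subtorusPeriod Φ W hW hWc) eY = 1 := by
      rw [heY]
      have h : (⇑((finCongr hsub.symm).trans eY₀) : Fin m → Fin (subRank W)) = ⇑eY₀ ∘ Fin.cast hsub.symm := rfl
      rw [h, orientationSign_comp_cast₅]
      exact hpos₀
    set Z := SubtorusFrame.ofSubspace Φ W hW hWc eY hpos with hZ
    -- `[Y] ∈ H²(X, ℤ) ∩ H^{1,1}` is the class of some `E ∈ NS(X)`
    have hγI : Z.cycleForm e ∈ integralHodgeClasses Φ 1 :=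
      (mem_integralHodgeClasses_iff Φ).2
        ⟨Z.cycleForm_mem_integralForms e,
          ((mem_hodgeClasses_iff Φ).1 (Z.cycleForm_mem_hodgeClasses (p := 1) e)).2⟩
    obtain ⟨η, hηNS, hηγ⟩ := (mem_integralHodgeClasses_one_iff_exists Φ).1 hγI
    refine ⟨η, (mem_neronSeveriGroup_iff Φ).1 hηNS, fun h0 ↦ ?_, ?_⟩
    · apply cycleForm_ofSubspace_ne_zero Φ W hW hWc eY hpos e
      rw [← hZ, ← hηγ, h0]
      ext v
      simp
    · apply ofRealForm_injective
      rw [ofRealForm_wedge, hηγ, hZ, SubtorusFrame.cycleForm_wedge_self_eq_zero Φ _ e (by norm_num)]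
      ext v
      simp
  · rintro ⟨η, hη, hne, hηη⟩
    obtain ⟨W, hW, hWc, eY, -, -, -, -⟩ := hη.exists_int_smul_cycleForm_of_wedge_self_eq_zero Φ e hne hηη
    exact ⟨W, hW, hWc, by simpa using (Fintype.card_congr eY).symm⟩

/-- **A complex torus of dimension `g ≥ 2` whose Néron–Severi group contains a non-zero class of square zero is
not simple**: it contains the abelian divisor `K(L)⁰` (of rank `2g − 2`, neither `0` nor everything).
[cite: Auffarth2015EllipticCurvesAbelianVarieties, §1 Thm. 1.1 ("In particular")] [cite: Lange2023AbelianVarietiesComplex, §1.5.4 (1.22), p. 58] -/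
theorem IsNSForm.not_isSimple_of_wedge_self_eq_zero [FiniteDimensional ℂ E] {m : ℕ} (e : Fin (m + 2) ≃ ι)
    (hm : 0 < m) {η : E [⋀^Fin 2]→L[ℝ] ℝ} (hη : IsNSForm Φ η) (hne : η ≠ 0) (hηη : η.wedge η = 0) :
    ¬ IsSimple Φ := by
  obtain ⟨W, hW, hWc, eY, -, hWt, -, -⟩ := hη.exists_int_smul_cycleForm_of_wedge_self_eq_zero Φ e hne hηη
  intro hS
  rcases hS W hW hWc with h | h
  · have h0 : subRank W = 0 := by rw [h]; exact subRank_bot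
    have h1 : m = subRank W := by simpa using Fintype.card_congr eY
    omega
  · exact hWt h

end AnyDimension

end ComplexTorus

end Literature.Geometry.Kaehler
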